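import Mathlib.GroupTheory.FreeGroup.IsFreeGroup
import Mathlib.GroupTheory.FreeGroup.NielsenSchreier
import Mathlib.GroupTheory.Abelianization.Defs
import Mathlib.GroupTheory.FiniteAbelian.Basic
import Mathlib.GroupTheory.Index
import Mathlib.Algebra.FreeAbelianGroup.Finsupp
import Mathlib.Algebra.GCDMonoid.Finset
import Mathlib.Algebra.GCDMonoid.Nat
import Mathlib.Algebra.Group.TypeTags.Hom
import HarnessLib

/-!
# Power subgroups of free groups: a characteristic finite-index subgroup modulo which a given
# element has prescribed order

Topic `Literature/GroupTheory/CombinatorialGroupTheory`; Mathlib-only, theorems only.  For a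
finitely generated free group `N` (Mathlib `IsFreeGroup N`, `Group.FG N`) and an element `u ∈ N`
detected by some homomorphism `χ : N → ℤ` (`χ u ≠ 0`, i.e. `u ∉ [N, N]`):

* `exists_characteristic_finiteIndex_zpow_mem_iff` — there is `d ≥ 1` such that for every
  `t ≥ 1` the verbal subgroup `V = N^{dt}[N, N]` (the preimage of the `dt`-th powers of the
  abelianization; characteristic, of finite index) satisfies `u ^ j ∈ V ↔ t ∣ j`: modulo `V`,
  `u` has order EXACTLY `t`.

Here `d` is the content (gcd of the coordinates) of the image of `u` in `N^{ab} ≅ ℤ^{(β)}`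
(`exists_content` for finitely supported integer vectors).  This "order control" is the step of
G. Baumslag's proof of the residual finiteness of free products of free groups with cyclic
amalgamation where compatible finite quotients of the two factors are produced
(`CyclicAmalgamResiduallyFinite.lean`): Baumslag, Trans. AMS 106 (1963) 193–209, §§3–4.

## References

* G. Baumslag, *On the residual finiteness of generalised free products of nilpotent groups*,
  Trans. Amer. Math. Soc. 106 (1963) 193–209. [Baumslag1963]
* R. C. Lyndon, P. E. Schupp, *Combinatorial Group Theory*, Springer (1977/2001), Ch. I §3
  (subgroups of free groups; verbal subgroups). [LyndonSchupp2001]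
-/

namespace Literature.GroupTheory.CombinatorialGroupTheory

open Function

universe u

/-! ### Content of an integer vector -/

section Finsupp

variable {β : Type u}

/-- Divisibility of a finitely supported integer vector by an integer is coordinatewise.
[folklore] -/
private theorem exists_smul_eq_iff_forall_dvd (n : ℤ) (x : β →₀ ℤ) :
    (∃ w : β →₀ ℤ, n • w = x) ↔ ∀ b, n ∣ x b := by
  constructor
  · rintro ⟨w, rfl⟩ b
    exact ⟨w b, by simp⟩
  · intro h
    refine ⟨x.mapRange (fun z => z / n) (by simp), ?_⟩
    ext b
    simp only [Finsupp.smul_apply, Finsupp.mapRange_apply, smul_eq_mul]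
    exact Int.mul_ediv_cancel' (h b)

/-- **Content.**  A nonzero finitely supported integer vector `v` has a content `d ≥ 1` (the gcd of
its coordinates): for every `t ≥ 1` and `j ∈ ℤ`, the vector `j • v` is divisible by `d t` iff
`t ∣ j`. [folklore] -/
private theorem exists_content (v : β →₀ ℤ) (hv : v ≠ 0) :
    ∃ d : ℕ, 0 < d ∧ ∀ t : ℕ, 0 < t → ∀ j : ℤ,
      (∀ b, ((d * t : ℕ) : ℤ) ∣ j * v b) ↔ (t : ℤ) ∣ j := by
  classical
  let s := v.support
  let d' : ℤ := s.gcd v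
  have hd' : d' ≠ 0 := by
    intro h
    apply hv
    ext b
    by_cases hb : b ∈ s
    · exact (Finset.gcd_eq_zero_iff.mp h) b hb
    · simpa [s] using hb
  refine ⟨d'.natAbs, Int.natAbs_pos.mpr hd', fun t ht j => ?_⟩
  have hdvd : ∀ b, d' ∣ v b := by
    intro b
    by_cases hb : b ∈ s
    · exact Finset.gcd_dvd hb
    · have : v b = 0 := by simpa [s] using hb
      rw [this]; exact dvd_zero _
  constructor
  · intro h
    -- `d t ∣ gcd_b (j v_b) ~ j d'`
    have h1 : ((d'.natAbs * t : ℕ) : ℤ) ∣ s.gcd (fun b => j * v b) :=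
      Finset.dvd_gcd fun b _ => h b
    have h2 : ((d'.natAbs * t : ℕ) : ℤ) ∣ j * d' :=
      (Finset.gcd_mul_left' (s := s) (f := fun b => v b) j).dvd_iff_dvd_right.mp h1
    have h3 : d'.natAbs * t ∣ j.natAbs * d'.natAbs := by
      have := Int.natAbs_dvd_natAbs.mpr h2
      rwa [Int.natAbs_natCast, Int.natAbs_mul] at this
    have h4 : t ∣ j.natAbs := by
      rw [mul_comm j.natAbs] at h3
      exact Nat.dvd_of_mul_dvd_mul_left (Int.natAbs_pos.mpr hd') h3
    exact Int.natCast_dvd.mpr h4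
  · rintro ⟨j, rfl⟩ b
    have h1 : ((d'.natAbs : ℕ) : ℤ) ∣ v b := Int.natAbs_dvd.mpr (hdvd b)
    have h2 : ((d'.natAbs : ℕ) : ℤ) * (t : ℤ) ∣ v b * ((t : ℤ) * j) :=
      mul_dvd_mul h1 (dvd_mul_right _ _)
    have h3 : ((d'.natAbs * t : ℕ) : ℤ) = ((d'.natAbs : ℕ) : ℤ) * (t : ℤ) := by push_cast; ring
    rw [h3, show (t : ℤ) * j * v b = v b * ((t : ℤ) * j) by ring]
    exact h2

end Finsupp

/-! ### Coordinates on the abelianization of a free group -/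

section FreeGroup

variable {N : Type u} [Group N] [IsFreeGroup N]

/-- The abelianization of a free group `N` in coordinates: an additive isomorphism
`N^{ab} ≃ ℤ^{(β)}`, `β` the free basis (Mathlib: `FreeAbelianGroup β ≃+ (β →₀ ℤ)`).
[cite: LyndonSchupp2001, Ch. I §3] -/
theorem exists_abelianization_addEquiv_finsupp :
    Nonempty (Additive (Abelianization N) ≃+ (IsFreeGroup.Generators N →₀ ℤ)) :=
  ⟨(MulEquiv.toAdditive (IsFreeGroup.toFreeGroup N).abelianizationCongr).trans
    (FreeAbelianGroup.equivFinsupp (IsFreeGroup.Generators N))⟩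

/-- If a homomorphism `χ : N → ℤ` does not kill `u`, the image of `u` in `N^{ab}` is nontrivial.
[cite: LyndonSchupp2001, Ch. I §3] -/
theorem abelianization_of_ne_one_of_apply_ne_one {M : Type u} [Group M]
    (χ : M →* Multiplicative ℤ) {u : M} (hu : χ u ≠ 1) : Abelianization.of u ≠ 1 := by
  intro h
  apply hu
  rw [← Abelianization.lift_apply_of χ u, h, map_one]

/-- **Order control in a free group.**  Let `N` be a finitely generated free group, `u ∈ N`, and
`χ : N →* ℤ` with `χ u ≠ 0`.  Then there is `d ≥ 1` such that for every `t ≥ 1` there is a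
CHARACTERISTIC subgroup `V ≤ N` of finite index with `u ^ j ∈ V ↔ t ∣ j` for all `j ∈ ℤ`
(namely `V = N^{dt}[N, N]`, `d` the content of `u` in `N^{ab}`). [cite: Baumslag1963, §3] -/
theorem exists_characteristic_finiteIndex_zpow_mem_iff [Group.FG N]
    (χ : N →* Multiplicative ℤ) (u : N) (hu : χ u ≠ 1) :
    ∃ d : ℕ, 0 < d ∧ ∀ t : ℕ, 0 < t → ∃ V : Subgroup N, V.FiniteIndex ∧
      (∀ (σ : N ≃* N) (n : N), n ∈ V → σ n ∈ V) ∧ ∀ j : ℤ, u ^ j ∈ V ↔ (t : ℤ) ∣ j := by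
  classical
  obtain ⟨ε⟩ := exists_abelianization_addEquiv_finsupp (N := N)
  let a : N →* Abelianization N := Abelianization.of
  have hau : a u ≠ 1 := abelianization_of_ne_one_of_apply_ne_one χ hu
  let v : IsFreeGroup.Generators N →₀ ℤ := ε (Additive.ofMul (a u))
  have hv : v ≠ 0 := by
    intro h
    apply hau
    have : Additive.ofMul (a u) = 0 := ε.injective (by rw [map_zero]; exact h)
    exact this
  obtain ⟨d, hd, hcontent⟩ := exists_content v hv
  refine ⟨d, hd, fun t ht => ?_⟩
  let k : ℕ := d * t
  have hk : k ≠ 0 := Nat.pos_iff_ne_zero.mp (Nat.mul_pos hd ht)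
  let R : Subgroup (Abelianization N) := (powMonoidHom k).range
  haveI : Group.FG (Abelianization N) := Group.fg_of_surjective (QuotientGroup.mk'_surjective _)
  haveI hR : R.FiniteIndex := Subgroup.finiteIndex_range_powMonoidHom_of_fg _ hk
  let V : Subgroup N := R.comap a
  refine ⟨V, ?_, ?_, ?_⟩
  · -- finite index: `a` is surjective
    have ha : Function.Surjective a := QuotientGroup.mk'_surjective _
    constructor
    show (R.comap a).index ≠ 0
    rw [Subgroup.index_comap_of_surjective R ha]
    exact hR.index_ne_zero
  · -- characteristic
    intro σ n hn
    obtain ⟨y, hy⟩ := Subgroup.mem_comap.mp hn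
    refine Subgroup.mem_comap.mpr ⟨Abelianization.map σ.toMonoidHom y, ?_⟩
    change (Abelianization.map σ.toMonoidHom y) ^ k = a (σ n)
    rw [← map_pow, show y ^ k = a n from hy, Abelianization.map_of]
    rfl
  · -- the order of `u` modulo `V` is exactly `t`
    intro j
    have key : u ^ j ∈ V ↔ ∃ w : IsFreeGroup.Generators N →₀ ℤ, (k : ℤ) • w = j • v := by
      rw [Subgroup.mem_comap]
      change (∃ y, y ^ k = a (u ^ j)) ↔ _
      rw [map_zpow]
      constructor
      · rintro ⟨y, hy⟩
        refine ⟨ε (Additive.ofMul y), ?_⟩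
        calc (k : ℤ) • ε (Additive.ofMul y) = ε ((k : ℤ) • Additive.ofMul y) :=
              (map_zsmul ε _ _).symm
          _ = ε (Additive.ofMul (y ^ (k : ℤ))) := by rw [ofMul_zpow]
          _ = ε (Additive.ofMul (a u ^ j)) := by rw [zpow_natCast, hy]
          _ = j • v := by rw [ofMul_zpow, map_zsmul]
      · rintro ⟨w, hw⟩
        refine ⟨Additive.toMul (ε.symm w), ?_⟩
        apply Additive.ofMul.injective
        apply ε.injective
        calc ε (Additive.ofMul (Additive.toMul (ε.symm w) ^ k))
            = (k : ℤ) • w := by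
              rw [ofMul_pow, map_nsmul, ofMul_toMul, AddEquiv.apply_symm_apply, natCast_zsmul]
          _ = ε (Additive.ofMul (a u ^ j)) := by rw [hw, ofMul_zpow, map_zsmul]
    rw [key, exists_smul_eq_iff_forall_dvd]
    simp only [Finsupp.smul_apply, smul_eq_mul]
    exact hcontent t ht j

end FreeGroup

end Literature.GroupTheory.CombinatorialGroupTheory
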